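import Literature.MathematicalPhysics.QuantumFieldTheory.Balaban1983to89.Node00.TorusCoverCubeMember

/-!
# NODE 00 — PRINT's SEPARATION ([6] (1.3)–(1.6) «dist(Ω_{n+1}, Ωᶜ_n) ≥ L^{n+1}ξM₁») DESCENDS TO ANY FINER BLOCK `M₁′ ≤ M₁∕2`, NO DIVISIBILITY: `Sect2.SeqSeparated M₁ s →
# Sect2.SeqSeparated M₁′ s` — the separation at the `H`-kernel block `L·M_h` that an `Adm22` of the per-cube MEET family asks, from the token's `Sect2.SeqSeparated ν.M₁ s` and the floor

Cell `pub-ymgap`, seat `pub-ymgap-dag-n07-e` g22 (node N07 = [15] = [Balaban1985Variational]; lane owner of the K0 road), MODULE 57b (cell bus; a SIBLING, so that nothing under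
the head's import chain — 57a → n07-w3 (A)∕(B) → FILE 7 — is re-elaborated).  `--kind proof --supports stmt-QuantumFields-20541`; count-neutral; theorems only, no `def`.
[6] = [Balaban1985RegularSpaces], [III] = [Balaban1988Convergent], [B6] = [Balaban1984PropagatorsII].  CONSUMED BY NAME: FILE 26 `Node00.TorusCoverCubeMember`
(`cover_mem_of_within_of_seqSeparated` — the METRIC form of the separation), lit `B14DomainGeom.within_of_idxNear`, def-P11's `Sect2.SeqSeparated` ∕ `Sect2.enlT`.

WHY.  The token of the S6 head quantifies `Sect2.SeqSeparated ν.M₁ s` with the V20-G floor `c ≤ ν.M₁`; `ν.M₁ : ℕ` is a free field of `Stage7Numerics` (no power-of-`L`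
structure), so NO divisibility `L·M_h ∣ ν.M₁` is available.  The OUTWARD meet edition of the head's HCHART (lane owner's ROAD WORD, 2026-08-28) wants
`Adm22 (domainsMeet (cubeDomains …) (domainsOfSeq s.Ω k ·)) R (L·M_h)` through dag-n07-w6's `adm22_meet_domainsOfSeq_seqOfRecord`, whose hypothesis `hsep` is
`Sect2.SeqSeparated (L·M_h) s`.  THIS FILE supplies it from the floor alone: a point of an `L^{n+1}M₁′`-cube touching a cube that meets `Ω_{n+1}` is within
`2·L^{n+1}M₁′ − 1 ≤ L^{n+1}M₁` of `Ω_{n+1}` when `2M₁′ ≤ M₁`, hence in `Ω_n` by the metric form of `SeqSeparated M₁`.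

CONTENTS.  ★★ `Sect2.seqSeparated_of_two_mul_le` · ★ `Sect2.seqSeparated_of_floor` (the token's letters: `2M′ ≤ c ≤ ν.M₁`).
HONEST FRAMING: integer ∕ sup-metric bookkeeping by name; nothing of [15]∕[6] asserted; no token discharged; stub 1-G ∕ K0⁷ ∕ K1⁹ NOT closed; N07 NOT discharged; counts unmoved
(typed 28∕28 · discharged 5∕27); one finite 𝕋⁴ programme at fixed ε — R4 closes the conditional finite-𝕋⁴ rung `BalabanLadder.UV` ONLY; the YM mass gap (Clay) is NOT proved by
any of this; nothing continuum ∕ ℝ⁴ ∕ OS.  No `def`, no `instance`, no `notation`, no `sorry`.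
-/

noncomputable section

namespace Literature.MathematicalPhysics.QuantumFieldTheory.Balaban1983to89.Node00

open B15Eq112TorusCover (cover)
open B14DomainGeom (Pt Within)
open B14.Eq213MaximalDomains (side)

variable {P : Params}

/-- ★★ **SEPARATION DESCENDS TO ANY BLOCK OF AT MOST HALF THE SIZE** (no divisibility asked): if one layer of `L^{n+1}M₁`-cubes around `Ω_{n+1}` lies in `Ω_n` for every
`1 ≤ n < k` (`Sect2.SeqSeparated M₁ s`), then so does one layer of `L^{n+1}M₁′`-cubes for every `0 < M₁′` with `2M₁′ ≤ M₁`: a point of a cube touching a cube that meets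
`Ω_{n+1}` is within `2·L^{n+1}M₁′ − 1 ≤ L^{n+1}M₁` of `Ω_{n+1}` (lit's `within_of_idxNear`), hence in `Ω_n` by FILE 26's metric form `cover_mem_of_within_of_seqSeparated`.
[cite: Balaban1985RegularSpaces, (1.3)–(1.6) p.77; Balaban1988Convergent, (2.1) p.254, p.256 («the distance between their boundaries»); Balaban1984PropagatorsII, (2.1)–(2.2) p.224] -/
theorem Sect2.seqSeparated_of_two_mul_le {D : ℕ → Set (Set (Site P 0))} {k M₁ M₁' : ℕ} (hM₁' : 0 < M₁') (h2 : 2 * M₁' ≤ M₁)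
    (s : B14.Eq218Concrete.Seq D k) (hsep : Sect2.SeqSeparated M₁ s) : Sect2.SeqSeparated M₁' s := by
  have hM₁ : 1 ≤ M₁ := by omega
  intro n hn hnk
  rintro _ ⟨z, ⟨y, hy, hzy⟩, rfl⟩
  have hs' : 0 < side P.L M₁' (n + 1) := B14.Eq213MaximalDomains.side_pos P.L_pos hM₁' _
  have hw := B14DomainGeom.within_of_idxNear (side P.L M₁' (n + 1)) 1 hs' hzy
  refine cover_mem_of_within_of_seqSeparated hM₁ s hsep hn hnk hy (hw.mono ?_)
  rw [side, side]
  have hL : (0 : ℤ) ≤ (P.L : ℤ) ^ (n + 1) := by positivity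
  have h2' : (2 : ℤ) * M₁' ≤ M₁ := by exact_mod_cast h2
  push_cast
  nlinarith

/-- ★ **THE TOKEN's SEPARATION AT THE `H`-BLOCK**: under a floor `c ≤ M₁` with `2·M′ ≤ c` (e.g. `M′ = L·M_h`: the S6 floor `(11d + 4ρ + M + Dw)·L ≤ c` with `L·M_h ∣ ρ`, `L ≤ ρ`
gives `2·L·M_h ≤ 4ρ ≤ c`), `Sect2.SeqSeparated M₁ s` yields `Sect2.SeqSeparated M′ s`. [cite: Balaban1985RegularSpaces, (1.3)–(1.6) p.77; Balaban1985Variational, p.304 lines 1–2 («R₁M₁ sufficiently big»)] -/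
theorem Sect2.seqSeparated_of_floor {D : ℕ → Set (Set (Site P 0))} {k M₁ M' c : ℕ} (hM' : 0 < M') (h2 : 2 * M' ≤ c) (hc : c ≤ M₁)
    (s : B14.Eq218Concrete.Seq D k) (hsep : Sect2.SeqSeparated M₁ s) : Sect2.SeqSeparated M' s :=
  Sect2.seqSeparated_of_two_mul_le hM' (h2.trans hc) s hsep

end Literature.MathematicalPhysics.QuantumFieldTheory.Balaban1983to89.Node00

end
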